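import Summits.BirchSwinnertonDyer.BirchSwinnertonDyer.Theorems.KolyvaginRoadThreePTDevissageUnipotentTwoFinal
import Mathlib.GroupTheory.PGroup
import Mathlib.Data.ZMod.QuotientGroup
import HarnessLib

/-!
# A module of order `p²` on which every element of `Γ_L` acts with `p`-power order is unipotent:
# the short exact sequence `0 → ℤ/p → M → ℤ/p → 0` of discrete `Γ_L`-modules

Route `KolyvaginRoadThree`, crux `ZhangSharpFrameAtThreeHL` (stmt-BirchSwinnertonDyer-19574), PT road,
instance (I) (`PT-ROAD-DESIGN-g19.md` §2 (I)): over the `p`-Sylow fixed field `L = K''`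
(`KolyvaginRoadThreePTSylowField`), every `σ ∈ Γ_L` acts on `M = E[p]` through an element of
`p`-power order.  This file turns that into the input of `middleExact_canonical_of_unipotentTwo_all`
(`KolyvaginRoadThreePTDevissageUnipotentTwoFinal`): for a finite discrete `Γ_L`-module `M` with
`p · M = 0`, `#M = p²` and `τ(σ)^{p^k} = 1` for every `σ`,

* the image `H ≤ Aut(M)` of `Γ_L` is a `p`-group, so it fixes a non-zero `b ∈ M`
  (`IsPGroup.exists_fixed_point_of_prime_dvd_card_of_fixed_point` with the fixed point `0`);
* `A := ℤ b` has order `p` and is fixed pointwise; `H` acts on `Q := M/A` (order `p`) fixing `0`, and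
  `#Fix ≡ #Q ≡ 0 (mod p)` forces `Fix = Q`: `Γ_L` acts trivially on `M/A`;
* packaged (`exists_unipotentTwo_data`): types `A`, `B` with trivial discrete `Γ_L`-modules `ρA`, `ρB`
  of order `p`, killed by `p`, and intertwining maps `f : A → M` (inclusion), `g : M → B`
  (projection) forming a short exact sequence (`IsSES`).

THEOREMS (and definitions with bodies); no named fact; no case of BSD.

References: [SerreLocalFields1979] IX §1 (a `p`-group acting on a `p`-group has non-trivial fixed
points; unipotence); Mathlib `IsPGroup.card_modEq_card_fixedPoints`.
-/

noncomputable section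

open Function Field

set_option linter.dupNamespace false
set_option autoImplicit false

namespace Summit.BirchSwinnertonDyer.BirchSwinnertonDyer.Theorems.KolyvaginRoadThreePT

open Literature.NumberTheory.GaloisRepresentations
open Literature.NumberTheory.GaloisRepresentations.DiscreteGaloisModule (homOfIntertwining)
open scoped ContRepresentation

section Group

variable {M : Type} [AddCommGroup M] {p : ℕ} [hp : Fact p.Prime]

/-- `#ℤb = p` for `b ≠ 0` killed by the prime `p`. [cite: SerreLocalFields1979, IX §1] -/
theorem natCard_zmultiples_eq (hpM : ∀ m : M, p • m = 0) {b : M} (hb0 : b ≠ 0) :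
    Nat.card (AddSubgroup.zmultiples b) = p := by
  rw [Nat.card_zmultiples]
  exact addOrderOf_eq_prime (hpM b) hb0

/-- `#(M/ℤb) = p` when `#M = p²`, `b ≠ 0`, `p · M = 0`. [cite: SerreLocalFields1979, IX §1] -/
theorem natCard_quot_eq (hpM : ∀ m : M, p • m = 0) {b : M} (hb0 : b ≠ 0) (hcard : Nat.card M = p ^ 2) :
    Nat.card (M ⧸ AddSubgroup.zmultiples b) = p := by
  have h := AddSubgroup.card_eq_card_quotient_mul_card_addSubgroup (AddSubgroup.zmultiples b)
  rw [hcard, natCard_zmultiples_eq hpM hb0, pow_two] at h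
  exact (Nat.eq_of_mul_eq_mul_right hp.out.pos h).symm

end Group

section Unipotent

variable {L : Type} [Field L] {M : Type} [AddCommGroup M] [TopologicalSpace M] [DiscreteTopology M]
  {p : ℕ} [hp : Fact p.Prime] (τ : DiscreteGaloisModule L M)

/-- The image `H ≤ Aut_ℤ(M)` of `Γ_L`. [cite: SerreLocalFields1979, IX §1] -/
def imageGroup : Subgroup (Module.End ℤ M)ˣ := (τ.toRepresentation.asGroupHom).range

omit hp in
/-- Elements of the image are `τ σ`. [cite: SerreLocalFields1979, IX §1] -/
theorem exists_eq_of_mem_imageGroup {h : (Module.End ℤ M)ˣ} (hh : h ∈ imageGroup τ) :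
    ∃ σ : absoluteGaloisGroup L, (h : Module.End ℤ M) = τ σ := by
  obtain ⟨σ, rfl⟩ := hh
  exact ⟨σ, Representation.asGroupHom_apply _ σ⟩

omit hp in
/-- **The image of `Γ_L` is a `p`-group** when every `τ σ` has `p`-power order.
[cite: SerreLocalFields1979, IX §1] -/
theorem isPGroup_imageGroup (hpow : ∀ σ : absoluteGaloisGroup L, ∃ k : ℕ, (τ σ) ^ (p ^ k) = 1) :
    IsPGroup p (imageGroup τ) := by
  intro g
  obtain ⟨h, hh⟩ := g
  obtain ⟨σ, rfl⟩ := hh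
  obtain ⟨k, hk⟩ := hpow σ
  refine ⟨k, Subtype.ext (Units.ext ?_)⟩
  change (((τ.toRepresentation.asGroupHom σ) ^ (p ^ k) : (Module.End ℤ M)ˣ) : Module.End ℤ M) = 1
  rw [Units.val_pow_eq_pow_val, Representation.asGroupHom_apply]
  exact hk

/-- **A non-zero vector fixed by `Γ_L`** (`#M = p²`, the image a `p`-group: the number of fixed points is
`≡ #M ≡ 0 (mod p)` and `0` is one of them). [cite: SerreLocalFields1979, IX §1 Thm. 1] -/
theorem exists_fixed_ne_zero [Finite M] (hpow : ∀ σ : absoluteGaloisGroup L, ∃ k : ℕ, (τ σ) ^ (p ^ k) = 1)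
    (hcard : Nat.card M = p ^ 2) :
    ∃ b : M, b ≠ 0 ∧ ∀ σ : absoluteGaloisGroup L, τ σ b = b := by
  have h0 : (0 : M) ∈ MulAction.fixedPoints (imageGroup τ) M := fun h => by
    change ((h : (Module.End ℤ M)ˣ) : Module.End ℤ M) 0 = 0
    exact map_zero _
  obtain ⟨b, hb, hb0⟩ := (isPGroup_imageGroup τ hpow).exists_fixed_point_of_prime_dvd_card_of_fixed_point M
    (by rw [hcard]; exact dvd_pow_self p two_ne_zero) h0
  refine ⟨b, fun h => hb0 h.symm, fun σ => ?_⟩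
  have := hb ⟨τ.toRepresentation.asGroupHom σ, σ, rfl⟩
  change ((τ.toRepresentation.asGroupHom σ : (Module.End ℤ M)ˣ) : Module.End ℤ M) b = b at this
  rwa [Representation.asGroupHom_apply] at this

variable {τ}

omit hp in
/-- `ℤb` is fixed pointwise when `b` is. [cite: SerreLocalFields1979, IX §1] -/
theorem apply_eq_self_of_mem_zmultiples {b : M} (hb : ∀ σ : absoluteGaloisGroup L, τ σ b = b)
    (σ : absoluteGaloisGroup L) {a : M} (ha : a ∈ AddSubgroup.zmultiples b) :
    τ σ a = a := by
  obtain ⟨n, rfl⟩ := AddSubgroup.mem_zmultiples_iff.mp ha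
  rw [map_zsmul, hb]

omit hp in
/-- `ℤb` is stable under every element of the image group. [cite: SerreLocalFields1979, IX §1] -/
theorem zmultiples_le_comap {b : M} (hb : ∀ σ : absoluteGaloisGroup L, τ σ b = b) (h : imageGroup τ) :
    AddSubgroup.zmultiples b ≤ (AddSubgroup.zmultiples b).comap
      (((h : (Module.End ℤ M)ˣ) : Module.End ℤ M).toAddMonoidHom) := by
  intro a ha
  obtain ⟨σ, hσ⟩ := exists_eq_of_mem_imageGroup τ h.2
  change ((h : (Module.End ℤ M)ˣ) : Module.End ℤ M) a ∈ AddSubgroup.zmultiples b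
  rw [hσ, apply_eq_self_of_mem_zmultiples hb σ ha]
  exact ha

/-- The action of the image group on `M/ℤb`. [cite: SerreLocalFields1979, IX §1] -/
@[reducible] def quotAction {b : M} (hb : ∀ σ : absoluteGaloisGroup L, τ σ b = b) :
    MulAction (imageGroup τ) (M ⧸ AddSubgroup.zmultiples b) where
  smul h q := QuotientAddGroup.map _ _ (((h : (Module.End ℤ M)ˣ) : Module.End ℤ M).toAddMonoidHom)
    (zmultiples_le_comap hb h) q
  one_smul q := by
    induction q using QuotientAddGroup.induction_on with
    | H m => rfl
  mul_smul h h' q := by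
    induction q using QuotientAddGroup.induction_on with
    | H m => rfl

/-- **`Γ_L` acts trivially on `M/ℤb`**: the image group fixes `0 ∈ M/ℤb`, `#(M/ℤb) = p`, and the number
of its fixed points is `≡ p (mod p)` and `≥ 1`, hence all of `M/ℤb`. [cite: SerreLocalFields1979, IX §1 Thm. 1] -/
theorem mk_apply_eq_mk [Finite M] (hpM : ∀ m : M, p • m = 0) {b : M} (hb0 : b ≠ 0)
    (hb : ∀ σ : absoluteGaloisGroup L, τ σ b = b)
    (hpow : ∀ σ : absoluteGaloisGroup L, ∃ k : ℕ, (τ σ) ^ (p ^ k) = 1)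
    (hcard : Nat.card M = p ^ 2) (σ : absoluteGaloisGroup L) (m : M) :
    (QuotientAddGroup.mk (τ σ m) : M ⧸ AddSubgroup.zmultiples b) = QuotientAddGroup.mk m := by
  letI := quotAction hb
  have hQ := natCard_quot_eq hpM hb0 hcard
  have hmod := (isPGroup_imageGroup τ hpow).card_modEq_card_fixedPoints (M ⧸ AddSubgroup.zmultiples b)
  -- every point is fixed
  have hall : ∀ q : M ⧸ AddSubgroup.zmultiples b,
      q ∈ MulAction.fixedPoints (imageGroup τ) (M ⧸ AddSubgroup.zmultiples b) := by
    by_contra hne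
    push Not at hne
    obtain ⟨q, hq⟩ := hne
    have hlt : Nat.card (MulAction.fixedPoints (imageGroup τ) (M ⧸ AddSubgroup.zmultiples b)) <
        Nat.card (M ⧸ AddSubgroup.zmultiples b) := by
      rw [Nat.card_coe_set_eq]
      refine lt_of_le_of_ne (Set.ncard_le_card _) fun h => hq ?_
      rw [(Set.eq_univ_iff_ncard _).mpr h]
      exact Set.mem_univ q
    have hpos : 0 < Nat.card (MulAction.fixedPoints (imageGroup τ) (M ⧸ AddSubgroup.zmultiples b)) := by
      rw [Nat.card_coe_set_eq, Set.ncard_pos]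
      exact ⟨0, fun h => by
        change QuotientAddGroup.map _ _ _ _ (0 : M ⧸ AddSubgroup.zmultiples b) = 0
        exact map_zero _⟩
    rw [hQ] at hmod hlt
    have hdvd : p ∣ Nat.card (MulAction.fixedPoints (imageGroup τ) (M ⧸ AddSubgroup.zmultiples b)) :=
      (Nat.modEq_zero_iff_dvd.mp (hmod.symm.trans (Nat.modEq_zero_iff_dvd.mpr dvd_rfl)))
    exact absurd (Nat.le_of_dvd hpos hdvd) (not_le.mpr hlt)
  have h := hall (QuotientAddGroup.mk m) ⟨τ.toRepresentation.asGroupHom σ, σ, rfl⟩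
  change (QuotientAddGroup.mk (((τ.toRepresentation.asGroupHom σ : (Module.End ℤ M)ˣ) : Module.End ℤ M) m) :
    M ⧸ AddSubgroup.zmultiples b) = _ at h
  rwa [Representation.asGroupHom_apply] at h


/-! ### The short exact sequence `0 → ℤb → M → M/ℤb → 0` of discrete `Γ_L`-modules -/

/-- The trivial discrete `Γ_L`-module on the fixed line `ℤb`. [cite: SerreLocalFields1979, IX §1] -/
def lineRep (b : M) : DiscreteGaloisModule L (AddSubgroup.zmultiples b) :=
  ContinuousRep.trivial _ ℤ _

/-- The inclusion `ℤb → M` as an intertwining map (the line is fixed pointwise).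
[cite: SerreLocalFields1979, IX §1] -/
def lineIncl {b : M} (hb : ∀ σ : absoluteGaloisGroup L, τ σ b = b) :
    (lineRep (L := L) b).toContRepresentation →ⁱL τ.toContRepresentation where
  toContinuousLinearMap := ⟨(AddSubgroup.zmultiples b).subtype.toIntLinearMap, continuous_of_discreteTopology⟩
  isIntertwining' σ := ContinuousLinearMap.ext fun a => by
    change ((a : AddSubgroup.zmultiples b) : M) = τ σ (a : M)
    exact (apply_eq_self_of_mem_zmultiples hb σ a.2).symm

/-- The packaged unipotent filtration: **a finite discrete `Γ_L`-module of order `p²` killed by `p` on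
which every `σ` acts with `p`-power order is an extension of two TRIVIAL modules of order `p`** —
types `A`, `B`, trivial modules `ρA`, `ρB`, intertwining maps `f : A → M`, `g : M → B` forming a short
exact sequence (the input of `middleExact_canonical_of_unipotentTwo_all`).
[cite: SerreLocalFields1979, IX §1 Thm. 1] -/
theorem exists_unipotentTwo_data [Finite M] (hpM : ∀ m : M, p • m = 0) (hcard : Nat.card M = p ^ 2)
    (hpow : ∀ σ : absoluteGaloisGroup L, ∃ k : ℕ, (τ σ) ^ (p ^ k) = 1) :
    ∃ (A B : Type) (_ : AddCommGroup A) (_ : TopologicalSpace A) (_ : DiscreteTopology A) (_ : Finite A)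
      (_ : AddCommGroup B) (_ : TopologicalSpace B) (_ : DiscreteTopology B) (_ : Finite B)
      (ρA : DiscreteGaloisModule L A) (ρB : DiscreteGaloisModule L B)
      (f : ρA.toContRepresentation →ⁱL τ.toContRepresentation)
      (g : τ.toContRepresentation →ⁱL ρB.toContRepresentation),
      (∀ (σ : absoluteGaloisGroup L) (a : A), ρA σ a = a) ∧ (∀ (σ : absoluteGaloisGroup L) (b : B), ρB σ b = b) ∧
      Nat.card A = p ∧ Nat.card B = p ∧ (∀ a : A, p • a = 0) ∧ (∀ b : B, p • b = 0) ∧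
      IsSES (homOfIntertwining f) (homOfIntertwining g) := by
  obtain ⟨b, hb0, hb⟩ := exists_fixed_ne_zero τ hpow hcard
  -- the quotient `M/ℤb` with the discrete topology and the trivial action
  haveI hQd : DiscreteTopology (M ⧸ AddSubgroup.zmultiples b) :=
    QuotientAddGroup.discreteTopology (isOpen_discrete _)
  let ρB : DiscreteGaloisModule L (M ⧸ AddSubgroup.zmultiples b) := ContinuousRep.trivial _ ℤ _
  let g : τ.toContRepresentation →ⁱL ρB.toContRepresentation :=
    { toContinuousLinearMap := ⟨(QuotientAddGroup.mk' (AddSubgroup.zmultiples b)).toIntLinearMap,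
        continuous_of_discreteTopology⟩
      isIntertwining' := fun σ => ContinuousLinearMap.ext fun m => by
        change (QuotientAddGroup.mk (τ σ m) : M ⧸ AddSubgroup.zmultiples b) = QuotientAddGroup.mk m
        exact mk_apply_eq_mk hpM hb0 hb hpow hcard σ m }
  refine ⟨AddSubgroup.zmultiples b, M ⧸ AddSubgroup.zmultiples b, inferInstance, inferInstance, inferInstance,
    inferInstance, inferInstance, inferInstance, hQd, inferInstance, lineRep b, ρB, lineIncl hb, g,
    fun _ _ => rfl, fun _ _ => rfl, natCard_zmultiples_eq hpM hb0, natCard_quot_eq hpM hb0 hcard,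
    fun a => Subtype.ext ?_, fun q => ?_, ⟨?_, ?_, ?_, ?_⟩⟩
  · change p • (a : M) = 0
    exact hpM a
  · induction q using QuotientAddGroup.induction_on with
    | H m =>
      change (QuotientAddGroup.mk (p • m) : M ⧸ AddSubgroup.zmultiples b) = 0
      rw [hpM, QuotientAddGroup.mk_zero]
  · refine TopRep.hom_ext (ContIntertwiningMap.ext (ContinuousLinearMap.ext fun a => ?_))
    change (QuotientAddGroup.mk ((a : AddSubgroup.zmultiples b) : M) : M ⧸ AddSubgroup.zmultiples b) = 0
    exact (QuotientAddGroup.eq_zero_iff _).mpr a.2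
  · exact Subtype.val_injective
  · intro m hm
    exact ⟨⟨m, (QuotientAddGroup.eq_zero_iff m).mp hm⟩, rfl⟩
  · exact QuotientAddGroup.mk'_surjective _

end Unipotent

end Summit.BirchSwinnertonDyer.BirchSwinnertonDyer.Theorems.KolyvaginRoadThreePT

end
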